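import Summits.NavierStokesRegularity.FluidComputer.PalasekTowerBurgersNumber
import Summits.NavierStokesRegularity.FluidComputer.PalasekTowerRegisterWindow

/-!
# REGISTER v2.3′: the Burgers number of `HeredityFromTwo`, part 2 — the STRAIN floor `c₁ A_{k+1}`
# read on the Burgers child core, and the DC1 margin `N_k^{β−2b}`

Evidence toward `stmt-NavierStokesRegularity-19250` (companion of `PalasekTowerBurgersNumber.lean`,
p433323; cell `ns-blowup`, seat `ns-blowup-ecbridge-8` (g3)). LABEL: MODEL-side register arithmetic
over the landed Literature theorems on the velocity GRADIENT of the Burgers vortex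
(`Literature/Analysis/FluidPDE/BurgersVortexPeakSpeed.lean` v2: on the axis `Dv = c·J` with
`‖Dv‖ = |c| = |γΓ|/(8πν)` — the solid-body core rotating at half the axis vorticity — and
`‖D(U_s + v)(x)‖ ≤ |γ| + 3|c|` everywhere, `‖D(U_s + v)(axis)‖ ≥ |c|`).

WHAT THIS IS NOT: not NS — the Burgers vortex is an exact steady infinite-energy profile and no
registered stage; nothing is asserted about any registered flow, about `ReadoutFloors` or the truth
of the child crux. The MODEL identification is that of part 1: «level-`(k+1)` core = Burgers vortex of
circulation `C·N_{k+1}^{β−2}` in the strain `λ·A_k`, `ν = 1`»; here the FULL field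
`burgersVortex (λ A_k) 1 (C N_{k+1}^{β−2}) = U_s + v` is read against the third floor of the register,
the strain floor `‖D u(τ_{k+1}, x)‖ ≥ c₁ A_{k+1}` at some `x` in the ball.

## The second identity and its exponent

  `A_k · N_{k+1}^{β−2} = N_k^{β−2b} · A_{k+1}`      (`palasekTowerBreakdown_burgers_strain_scaling`),

and `N_k^{β−2b} = A_k / N_{k+1}²` is the register's DC1 margin (`1.74` at `k = 0` on wide, `→ ∞`;
exponent `β − 2b > 0` by Palasek's (3.2), `= 1/10` on wide). So the core rotation rate of the Burgers
child core is `c = (Cλ/8π) · N_k^{β−2b} · A_{k+1}`: the strain floor `c₁ A_{k+1}` is met ON THE AXIS as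
soon as `Cλ · N_k^{β−2b} ≥ 8π c₁` (`_strainFloor_axis`; wide/Rigid: `Cλ · N_k^{1/10} ≥ 25.2`, i.e.
`Cλ ≥ 12.9` at `k = 2`), and it is missed EVERYWHERE on the profile if
`λ A_k (1 + 3C N_{k+1}^{β−2}/(8π)) < c₁ A_{k+1}` (`_strainFloor_missed`). Combined with part 1: if the
velocity floor `c₁ Y_{k+1}` is met on the swirl of a child core with `C ≤ 12`, the strain floor holds
on its axis automatically (`_strainFloor_of_velocityFloor`; `(C√λ N_k^{1/20})² = C · (Cλ N_k^{1/10})`),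
so for modestly endowed child cores the binding readouts are the velocity floor and the ceiling — the
band `17 < C√λ · N_k^{1/20} < 34` of part 1.

## The compaction clock (§4, kinematic)

The axisymmetric strain `λA_k` contracts horizontal material radii like `r(t) = r₀ e^{−λA_k t/2}`
(Saffman 1992 §13.3 (26)–(27): Lundgren's variables `R = S^{1/2} r`, `S(t) = e^{γt}`), so carrying the
parent core scale `r₀ = 1/N_k` down to the Burgers radius `δ = (λA_k)^{−1/2}` costs
`ln(r₀/δ) = ((β−2) ln N_k + ln λ)/2` e-foldings (`_compaction_efolds`) and the kinematic time
`t_c = ((β−2) ln N_k + ln λ)/(λ A_k)` (`_compaction_clock`); at `λ = 1` this is EXACTLY the fraction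
`(β−2)/(4b²β)` of the rigid growth window `w_k = 4bβ log N_{k+1}/A_k` (`_compaction_clock_window`,
`_rigid_window`) — `75/2783 < 1/37` on wide (`_compaction_fraction_wide`): the rigid clock leaves the
kinematic compaction a ×37 margin (the window is sized by Palasek's transfer time, not by compaction).
WHAT THIS IS NOT: an advection estimate for the exact strain field, not the vorticity dynamics of any flow.

References: P. G. Saffman, *Vortex Dynamics*, CUP 1992, §13.3 (9), (12) [cite: Saffman1992, §13.3 eq. (12)];
S. Palasek, arXiv:2605.13827, §3 (3.2) [cite: Palasek2026ElementaryModel, §3 (3.2)].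
-/

namespace Summit.NavierStokesRegularity.FluidComputer.PalasekTowerClayBridge

open Real Filter Topology
open Literature.Analysis.FluidPDE

/-! ## §1 The strain-side scaling identity and the DC1 exponent -/

/-- Palasek's admissibility `2b < β` (DC1): the exponent `β − 2b` is positive. -/
theorem palasekTowerBreakdown_burgers_strainExponent_pos (R : TowerRates) : 0 < R.β - 2 * R.b := by
  have h := R.two_b_lt_β
  linarith

/-- On the wide rates `β − 2b = 1/10`. -/
theorem palasekTowerBreakdown_burgers_strainExponent_wide :
    TowerRates.wide.β - 2 * TowerRates.wide.b = 1 / 10 := by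
  simp only [TowerRates.wide]
  norm_num

/-- **The strain-side scaling identity**: `A_k · N_{k+1}^{β−2} = N_k^{β−2b} · A_{k+1}`. -/
theorem palasekTowerBreakdown_burgers_strain_scaling (R : TowerRates) (k : ℕ) :
    R.A k * R.N (k + 1) ^ (R.β - 2) = R.N k ^ (R.β - 2 * R.b) * R.A (k + 1) := by
  have hN := R.N_pos k
  rw [TowerRates.A, TowerRates.A, R.N_succ k, ← Real.rpow_mul hN.le, ← Real.rpow_mul hN.le,
    ← Real.rpow_add hN, ← Real.rpow_add hN]
  congr 1
  ring

/-- **The DC1 margin**: `N_k^{β−2b} = A_k / N_{k+1}²` (the pump `A_k` against the dissipation rate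
`N_{k+1}²` of the next level, `ν = 1`). -/
theorem palasekTowerBreakdown_dc1Margin_eq (R : TowerRates) (k : ℕ) :
    R.N k ^ (R.β - 2 * R.b) = R.A k / R.N (k + 1) ^ 2 := by
  have hN := R.N_pos k
  rw [TowerRates.A, R.N_succ k, ← Real.rpow_natCast, ← Real.rpow_mul hN.le, Real.rpow_sub hN]
  norm_num
  ring_nf

/-- The DC1 margin exceeds one and diverges along the tower. -/
theorem palasekTowerBreakdown_one_lt_dc1Margin (R : TowerRates) (k : ℕ) :
    1 < R.N k ^ (R.β - 2 * R.b) :=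
  Real.one_lt_rpow (R.one_lt_N k) (palasekTowerBreakdown_burgers_strainExponent_pos R)

/-- The DC1 margin diverges along the tower. -/
theorem palasekTowerBreakdown_tendsto_dc1Margin (R : TowerRates) :
    Tendsto (fun k => R.N k ^ (R.β - 2 * R.b)) atTop atTop :=
  (tendsto_rpow_atTop (palasekTowerBreakdown_burgers_strainExponent_pos R)).comp R.tendsto_N_atTop

/-! ## §2 The strain floor `c₁ A_{k+1}` on the Burgers child core -/

/-- The core rotation rate of the Burgers child core: `|γΓ/(8π·1)| = (Cλ/8π) · N_k^{β−2b} · A_{k+1}`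
for `γ = λ A_k`, `Γ = C N_{k+1}^{β−2}`, `C ≥ 0`, `λ > 0`. -/
theorem palasekTowerBreakdown_burgers_coreRate (R : TowerRates) (k : ℕ) {C l : ℝ} (hC : 0 ≤ C)
    (hl : 0 < l) :
    |l * R.A k * (C * R.N (k + 1) ^ (R.β - 2)) / (8 * π * 1)| =
      C * l / (8 * π) * R.N k ^ (R.β - 2 * R.b) * R.A (k + 1) := by
  have hA := R.A_pos k
  have hNp : 0 ≤ R.N (k + 1) ^ (R.β - 2) := Real.rpow_nonneg (R.N_pos _).le _
  have hnn : 0 ≤ l * R.A k * (C * R.N (k + 1) ^ (R.β - 2)) / (8 * π * 1) := by positivity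
  rw [abs_of_nonneg hnn, show l * R.A k * (C * R.N (k + 1) ^ (R.β - 2)) =
    C * l * (R.A k * R.N (k + 1) ^ (R.β - 2)) by ring, palasekTowerBreakdown_burgers_strain_scaling]
  ring

/-- **The strain floor is met ON THE AXIS of the Burgers child core** as soon as
`Cλ · N_k^{β−2b} ≥ 8π c₁`: then `‖D u(0)‖ ≥ c₁ A_{k+1}` for `u = burgersVortex (λA_k) 1 (C N_{k+1}^{β−2})`. -/
theorem palasekTowerBreakdown_burgers_strainFloor_axis (R : TowerRates) (k : ℕ) {C l c₁ : ℝ}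
    (hC : 0 ≤ C) (hl : 0 < l) (hP : 8 * π * c₁ ≤ C * l * R.N k ^ (R.β - 2 * R.b)) :
    ∃ x : EuclideanSpace ℝ (Fin 3),
      c₁ * R.A (k + 1) ≤ ‖fderiv ℝ (burgersVortex (l * R.A k) 1 (C * R.N (k + 1) ^ (R.β - 2))) x‖ := by
  refine ⟨0, ?_⟩
  have h := le_norm_fderiv_burgersVortex_axis (l * R.A k) 1 (C * R.N (k + 1) ^ (R.β - 2))
    (x := (0 : EuclideanSpace ℝ (Fin 3))) rfl rfl
  rw [palasekTowerBreakdown_burgers_coreRate R k hC hl] at h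
  refine le_trans ?_ h
  have hA : 0 < R.A (k + 1) := R.A_pos _
  have hpi := Real.pi_pos
  have h1 : c₁ ≤ C * l / (8 * π) * R.N k ^ (R.β - 2 * R.b) := by
    rw [div_mul_eq_mul_div, le_div_iff₀ (by positivity)]
    linarith
  exact mul_le_mul_of_nonneg_right h1 hA.le

/-- **The strain floor is missed EVERYWHERE on the Burgers child core** when
`λ A_k · (1 + 3 C N_{k+1}^{β−2}/(8π)) < c₁ A_{k+1}` (strain rate plus thrice the core rotation rate
below the floor). -/
theorem palasekTowerBreakdown_burgers_strainFloor_missed (R : TowerRates) (k : ℕ) {C l c₁ : ℝ}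
    (hC : 0 ≤ C) (hl : 0 < l)
    (hP : l * R.A k * (1 + 3 * (C * R.N (k + 1) ^ (R.β - 2)) / (8 * π)) < c₁ * R.A (k + 1))
    (x : EuclideanSpace ℝ (Fin 3)) :
    ‖fderiv ℝ (burgersVortex (l * R.A k) 1 (C * R.N (k + 1) ^ (R.β - 2))) x‖ < c₁ * R.A (k + 1) := by
  have hA := R.A_pos k
  have hγ : 0 < l * R.A k := mul_pos hl hA
  have h := norm_fderiv_burgersVortex_le hγ one_pos (C * R.N (k + 1) ^ (R.β - 2)) x
  refine h.trans_lt ?_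
  have hNp : 0 ≤ R.N (k + 1) ^ (R.β - 2) := Real.rpow_nonneg (R.N_pos _).le _
  have hpi := Real.pi_pos
  have hnn : 0 ≤ l * R.A k * (C * R.N (k + 1) ^ (R.β - 2)) / (8 * π * 1) := by positivity
  rw [abs_of_pos hγ, abs_of_nonneg hnn]
  have : l * R.A k + 3 * (l * R.A k * (C * R.N (k + 1) ^ (R.β - 2)) / (8 * π * 1)) =
      l * R.A k * (1 + 3 * (C * R.N (k + 1) ^ (R.β - 2)) / (8 * π)) := by
    simp only [mul_one]
    ring
  rw [this]
  exact hP

/-! ## §3 The register's constants (wide rates, `Schedule.Rigid`) -/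

/-- Numerics: `8π < 25.2`. -/
theorem palasekTowerBreakdown_eight_pi_lt : 8 * π < (25.2 : ℝ) := by
  have := Real.pi_lt_d2
  linarith

/-- **Under the register's constants**: on the wide rates with `Schedule.Rigid` (`c₁ = 1`), the strain
floor `S.c₁ · A_{k+1}` is met on the axis of the Burgers child core as soon as
`Cλ · N_k^{1/10} ≥ 25.2` (`8π = 25.13…`; at `k = 2`, `N_2^{1/10} ≈ 1.96`: `Cλ ≥ 12.9`). -/
theorem palasekTowerBreakdown_burgers_strainFloor_axis_rigid (S : Schedule TowerRates.wide)
    (hS : S.Rigid) (k : ℕ) {C l : ℝ} (hC : 0 ≤ C) (hl : 0 < l)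
    (hP : 25.2 ≤ C * l * TowerRates.wide.N k ^ (1 / 10 : ℝ)) :
    ∃ x : EuclideanSpace ℝ (Fin 3), S.c₁ * TowerRates.wide.A (k + 1) ≤
      ‖fderiv ℝ (burgersVortex (l * TowerRates.wide.A k) 1
        (C * TowerRates.wide.N (k + 1) ^ (TowerRates.wide.β - 2))) x‖ := by
  refine palasekTowerBreakdown_burgers_strainFloor_axis TowerRates.wide k hC hl ?_
  rw [palasekTowerBreakdown_burgers_strainExponent_wide, hS.c₁_eq]
  have := palasekTowerBreakdown_eight_pi_lt
  linarith

/-- `(N_k^{1/20})² = N_k^{1/10}`. -/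
theorem palasekTowerBreakdown_burgersFactor_sq (k : ℕ) :
    (TowerRates.wide.N k ^ (1 / 20 : ℝ)) ^ 2 = TowerRates.wide.N k ^ (1 / 10 : ℝ) := by
  rw [← Real.rpow_natCast, ← Real.rpow_mul (TowerRates.wide.N_pos k).le]
  norm_num

/-- **For modestly endowed child cores the strain floor follows from the velocity floor**: on the wide
rates with `Schedule.Rigid`, if the velocity floor `S.c₁ · Y_{k+1}` is met on the swirl of a Burgers
child core of circulation constant `0 < C ≤ 12`, then the strain floor `S.c₁ · A_{k+1}` is met on its
axis (`(C√λ N_k^{1/20})² ≥ (4√2π)² = 32π² > 315`, so `Cλ N_k^{1/10} ≥ 315/12 > 25.2`). -/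
theorem palasekTowerBreakdown_burgers_strainFloor_of_velocityFloor (S : Schedule TowerRates.wide)
    (hS : S.Rigid) (k : ℕ) {C l : ℝ} (hC : 0 < C) (hC12 : C ≤ 12) (hl : 0 < l)
    (hfloor : ∃ x : EuclideanSpace ℝ (Fin 3), S.c₁ * TowerRates.wide.Y (k + 1) ≤
      ‖burgersVortexSwirl (l * TowerRates.wide.A k) 1
        (C * TowerRates.wide.N (k + 1) ^ (TowerRates.wide.β - 2)) x‖) :
    ∃ x : EuclideanSpace ℝ (Fin 3), S.c₁ * TowerRates.wide.A (k + 1) ≤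
      ‖fderiv ℝ (burgersVortex (l * TowerRates.wide.A k) 1
        (C * TowerRates.wide.N (k + 1) ^ (TowerRates.wide.β - 2))) x‖ := by
  -- the velocity floor on the core forces `P := C√λ N_k^{1/20} ≥ 4√2π`
  have hP : 4 * Real.sqrt 2 * π * S.c₁ ≤
      C * Real.sqrt l * TowerRates.wide.N k ^ (TowerRates.wide.β / 2 - TowerRates.wide.b) := by
    rcases lt_or_ge (C * Real.sqrt l * TowerRates.wide.N k ^ (TowerRates.wide.β / 2 - TowerRates.wide.b))
        (4 * Real.sqrt 2 * π * S.c₁) with h | h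
    · obtain ⟨x, hx⟩ := hfloor
      exact absurd hx (not_le.2 (palasekTowerBreakdown_burgers_lt_floor TowerRates.wide k hC.le hl h x))
    · exact h
  rw [palasekTowerBreakdown_burgers_exponent_wide, hS.c₁_eq, mul_one] at hP
  refine palasekTowerBreakdown_burgers_strainFloor_axis_rigid S hS k hC.le hl ?_
  -- square: `C² λ N^{1/10} ≥ 32 π²`
  have hs2 : Real.sqrt 2 ^ 2 = 2 := Real.sq_sqrt (by norm_num)
  have hsl : Real.sqrt l ^ 2 = l := Real.sq_sqrt hl.le
  have hpos : 0 ≤ 4 * Real.sqrt 2 * π := by positivity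
  have hsq := pow_le_pow_left₀ hpos hP 2
  rw [mul_pow, mul_pow, mul_pow, mul_pow, hs2, hsl, palasekTowerBreakdown_burgersFactor_sq] at hsq
  have hpi := Real.pi_gt_d2
  have hN : 0 < TowerRates.wide.N k ^ (1 / 10 : ℝ) := Real.rpow_pos_of_pos (TowerRates.wide.N_pos k) _
  -- `C · (C l N^{1/10}) ≥ 32π² > 315 ≥ 12 · 25.2 ≥ C · 25.2`
  have h1 : C * (25.2 : ℝ) ≤ 12 * 25.2 := by nlinarith
  have h2 : (12 : ℝ) * 25.2 < 4 ^ 2 * 2 * π ^ 2 := by nlinarith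
  have h3 : 4 ^ 2 * 2 * π ^ 2 ≤ C * (C * l * TowerRates.wide.N k ^ (1 / 10 : ℝ)) := by
    have : C ^ 2 * l * TowerRates.wide.N k ^ (1 / 10 : ℝ) = C * (C * l * TowerRates.wide.N k ^ (1 / 10 : ℝ)) := by
      ring
    rw [← this]; exact hsq
  nlinarith

/-! ## §4 The compaction clock (kinematic contraction by the strain `λ A_k`) -/

/-- **E-foldings of compaction**: the parent core scale `1/N_k` over the Burgers radius
`(λA_k)^{−1/2}` is `√λ · N_k^{β/2−1}`, of logarithm `((β−2) ln N_k + ln λ)/2`. -/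
theorem palasekTowerBreakdown_compaction_efolds (R : TowerRates) (k : ℕ) {l : ℝ} (hl : 0 < l) :
    Real.log (Real.sqrt (l * R.A k) / R.N k) = ((R.β - 2) * Real.log (R.N k) + Real.log l) / 2 := by
  have hN := R.N_pos k
  have hA := R.A_pos k
  rw [Real.log_div (Real.sqrt_pos.2 (mul_pos hl hA)).ne' hN.ne', Real.log_sqrt (mul_pos hl hA).le,
    Real.log_mul hl.ne' hA.ne', TowerRates.A, Real.log_rpow hN]
  ring

/-- **The kinematic compaction time** `t_c = (2/γ) ln(r₀/δ)` of the strain `γ = λA_k` (radial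
contraction `r(t) = r₀ e^{−γt/2}`, Saffman 1992 §13.3 (26)–(27)) from `r₀ = 1/N_k` to the Burgers radius:
`t_c = ((β−2) ln N_k + ln λ)/(λ A_k)`. -/
theorem palasekTowerBreakdown_compaction_clock (R : TowerRates) (k : ℕ) {l : ℝ} (hl : 0 < l) :
    2 / (l * R.A k) * Real.log (Real.sqrt (l * R.A k) / R.N k) =
      ((R.β - 2) * Real.log (R.N k) + Real.log l) / (l * R.A k) := by
  rw [palasekTowerBreakdown_compaction_efolds R k hl]
  have hA := R.A_pos k
  field_simp

/-- **At `λ = 1` the compaction time is the fraction `(β−2)/(4b²β)` of the growth window**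
`w_k = 4bβ log N_{k+1}/A_k` (`TowerRates.window`; `log N_{k+1} = b log N_k`). -/
theorem palasekTowerBreakdown_compaction_clock_window (R : TowerRates) (k : ℕ) :
    (R.β - 2) * Real.log (R.N k) / R.A k = (R.β - 2) / (4 * R.b ^ 2 * R.β) * R.window k := by
  have hA := R.A_pos k
  have hb : 0 < R.b := lt_trans one_pos R.one_lt_b
  have hβ : 0 < R.β := lt_trans two_pos R.two_lt_β
  rw [TowerRates.window, R.log_N_succ k]
  field_simp

/-- Under `Schedule.Rigid` the readout gap IS the growth window: `τ_{k+1} − τ_k = w_k`. -/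
theorem palasekTowerBreakdown_rigid_window {R : TowerRates} {S : Schedule R} (hS : S.Rigid) (k : ℕ) :
    S.τ (k + 1) - S.τ k = R.window k := by
  rw [hS.window_eq k, hS.c₅_eq, TowerRates.window]
  ring

/-- **On the wide rates the compaction fraction is `75/2783 < 1/37`**: the rigid clock leaves the
kinematic compaction of a `λ = 1` child core a margin `> 37` (larger `λ` only helps, up to the
`ln λ/(λA_k)` term of `_compaction_clock`). -/
theorem palasekTowerBreakdown_compaction_fraction_wide :
    (TowerRates.wide.β - 2) / (4 * TowerRates.wide.b ^ 2 * TowerRates.wide.β) = 75 / 2783 ∧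
      (75 : ℝ) / 2783 < 1 / 37 := by
  refine ⟨?_, by norm_num⟩
  simp only [TowerRates.wide]
  norm_num

/-- **The compaction clock under the register** (wide, `Schedule.Rigid`, `λ = 1`): the kinematic
compaction time from `1/N_k` to `A_k^{−1/2}` is less than `(τ_{k+1} − τ_k)/37`. -/
theorem palasekTowerBreakdown_compaction_clock_rigid (S : Schedule TowerRates.wide) (hS : S.Rigid)
    (k : ℕ) :
    2 / (1 * TowerRates.wide.A k) * Real.log (Real.sqrt (1 * TowerRates.wide.A k) / TowerRates.wide.N k) <
      (S.τ (k + 1) - S.τ k) / 37 := by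
  rw [palasekTowerBreakdown_compaction_clock TowerRates.wide k one_pos, Real.log_one, add_zero, one_mul,
    palasekTowerBreakdown_compaction_clock_window, palasekTowerBreakdown_rigid_window hS k]
  obtain ⟨h1, h2⟩ := palasekTowerBreakdown_compaction_fraction_wide
  rw [h1]
  have hw : 0 < TowerRates.wide.window k := TowerRates.wide.window_pos k
  rw [lt_div_iff₀ (by norm_num : (0 : ℝ) < 37)]
  nlinarith

end Summit.NavierStokesRegularity.FluidComputer.PalasekTowerClayBridge
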